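import Summits.BirchSwinnertonDyer.BirchSwinnertonDyer.Theorems.UniversalToricDescentResidualSelmerTransport
import Summits.BirchSwinnertonDyer.BirchSwinnertonDyer.Theorems.UniversalToricDescentResidualSelmerFinite
import Summits.BirchSwinnertonDyer.Rank1Residual.X2.ResidualDevissageSelmer
import Summits.BirchSwinnertonDyer.Rank1Residual.X2.ResidualDevissageModules
import Literature.NumberTheory.EllipticCurves.SelmerCorankProofs
import HarnessLib

/-!
# Crux K1 `CumulativeHeegnerInclusionAtThree` (stmt-BirchSwinnertonDyer-24198), line `birth`, stub B1
# `stub_residualSelmerFinite` — the RESIDUAL DEVISSAGE of Castella's anticyclotomic residual Selmer group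
# along `0 → Φ → M → Ψ → 0` (Castella–Grossi–Lee–Skinner 2022 §3 Prop. 3.2.4 = arXiv:2008.02571 Prop. 17,
# the `E`-dependent step of «`Sel_{𝔭′}(K_∞, E[p^∞])[p]` finite», reduction-type free)

Lead prover bsd-line-chl-k1-p1 g2 (`--supports stmt-BirchSwinnertonDyer-24198`). Stub B1 of line `birth`
(«on the Leopoldt cell, `Sel_{𝔭′}(K_∞, E[3^∞])[3]` is finite») is Castella–Grossi–Lee–Skinner, Invent.
Math. 227 (2022) §3 with the standing hypothesis «good reduction at `p`» deleted. Their proof (arXiv §1,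
Props. 14, 17, 18) is: (i) the residual Selmer groups of the two CHARACTERS `φ`, `ψ = ωφ⁻¹` of
`E[p]^ss` are finite (Rubin's main conjecture + Hida's `μ = 0`, their Thm. 11 / Prop. 14 — a statement
about Hecke characters of `K`, no elliptic curve in it); (ii) the residual Selmer group of `E[p]` is then
finite by the DEVISSAGE along `0 → 𝔽_p(φ) → E[p] → 𝔽_p(ψ) → 0` (Prop. 17); (iii) `Sel(E[p^∞])[p]` is a
quotient of the residual group of `E[p]` (Prop. 18). Step (iii) is the tree's
`UniversalToricDescentResidualSelmerFinite.finite_selmerAc_pTorsion_of_finite_residualSelmer` (Lim–Sujatha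
form, any reduction type, any `ℤ_p`-extension with `𝔭` finitely decomposed). THIS FILE proves step (ii)
for Castella's anticyclotomic local conditions (STRICT at the distinguished `𝔭`, relaxed at the other
places above `p`, unramified outside `Σ`), i.e. for the EXISTING Literature group
`R_𝔭^Σ(L, X) := GreenbergVatsal2000.datumStrictSelmer H X p (AcSelmer.bdpData X p 𝔭) Σ ⊆ H¹(H, X)`
over `L = K̄^H` (`H` normal in `Γ_K`; `H = ker κ` for `L = K_∞`), and assembles (ii)+(iii):

* §1 `mem_strictKer_strictDatum_of_subH1` — BACKWARD transport of Castella's strict condition along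
  `i_* : H¹(H, Φ) → H¹(H, M)`: if `Ψ^{H ⊓ D_𝔭} ⊆ q(M^{H ⊓ D_𝔭})` (e.g. `Ψ^{H ⊓ D_𝔭} = 0`) then
  `H¹(H ⊓ D_𝔭, Φ) → H¹(H ⊓ D_𝔭, M)` is injective (tree `pushH1_injective_of_surjOn_fixed`), so `i_* c`
  strict at `𝔭` forces `c` strict at `𝔭` (naturality `resOfLe_comp_resH1Hom_id`, criterion
  `mem_strictKer_strictDatum_iff`). Forward transport is the tree's `resH1Hom_id_mem_residualSelmer`.
* §2 `exists_mem_residualSelmer_subH1_eq` — the kernel of `q_*` on `R_𝔭^Σ(L, M)` comes from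
  `R_𝔭^Σ(L, Φ)` (exactness of `H¹(H, Φ) → H¹(H, M) → H¹(H, Ψ)`, tree
  `mem_range_pushH1_of_pushH1_eq_zero`; unramified transport `mem_unramifiedOutside_of_subH1` for `M`
  unramified outside `Σ ∪ {v ∣ p}`; §1 at `𝔭` for every conjugate).
* §3 **`finite_residualSelmer_of_subquotient`** — `R_𝔭^Σ(L, Φ)` finite ∧ `R_𝔭^Σ(L, Ψ)` finite ⟹
  `R_𝔭^Σ(L, M)` finite (the map `q_*` on `R(M)` has range in `R(Ψ)` and finite kernel). This is CGLS
  Prop. 17's «in particular `H¹_{F_Gr}^S(K, M_E[p])` is finite» in the `K_∞`-formulation, for ANY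
  short exact sequence of discrete `Γ_K`-modules, any normal `H`, any `𝔭`, any `Σ`.
* §4 the packaging by a `Γ_K`-stable subgroup (`X2.ResidualDevissageModules.StableSubgroup`: `S.Sub`,
  `S.Quot`): `finite_residualSelmer_of_stableSubgroup` (hypotheses: `M` with continuous orbit maps,
  unramified outside `Σ ∪ {v ∣ p}`, `(M ⧸ S)^{H ⊓ D_𝔭} = 0`).
* §5 the elliptic-curve assembly with (iii): **`finite_selmerAc_pTorsion_of_line_devissage`** — for
  `E = W/K` over a number field, any `ℤ_p`-extension `κ`, `𝔭 ∋ p` finitely decomposed in `K_∞`, `Σ`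
  containing the bad places prime to `p`, and a `Γ_K`-stable `Φ ≤ E[p]` with `(E[p]/Φ)^{G_{K_∞,𝔭}} = 0`:
  `R_𝔭^Σ(K_∞, Φ)` finite ∧ `R_𝔭^Σ(K_∞, E[p]/Φ)` finite ⟹ `Sel_𝔭^Σ(K_∞, E[p^∞])[p]` finite, and the same for
  `Σ = ∅` (`finite_selmerAc_empty_pTorsion_of_line_devissage`, the SHAPE OF STUB B1: there `K` is the
  Heegner field, `κ` anticyclotomic, `p = 3`, `𝔭 = 𝔭′`, `Φ` = the rational line, and the two residual
  finiteness inputs are CGLS Prop. 14 for `φ|G_K`, `ψ|G_K`).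

THEOREMS ONLY; no definition, no named fact, no `sorry`; imports no `Theses` module. BSD is not proved by
any of this (it is Galois-cohomology bookkeeping on constructed objects).
References: [CastellaGrossiLeeSkinner2022] §3 (arXiv:2008.02571 §1: Lemma 13, Prop. 14, Props. 17–18);
[GreenbergVatsal2000] §2 pp. 28–30 (display (16)); [LimSujatha2018] §3 Prop. 3.2; [Castella2018] Def. 2.2;
[SerreGaloisCohomology1997] I.§2.2–2.5.
-/

set_option autoImplicit false
-- `…BirchSwinnertonDyer.BirchSwinnertonDyer.Theorems…` is the problem's mandated namespace (D-0017).
set_option linter.dupNamespace false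

noncomputable section

open scoped Classical

universe u

namespace Summit.BirchSwinnertonDyer.BirchSwinnertonDyer.Theorems.CumulativeHeegnerInclusionAtThreeResidualDevissage

open NumberField IsDedekindDomain Field
open Literature.NumberTheory.EllipticCurves Literature.NumberTheory.EllipticCurves.GreenbergSelmer
  Literature.NumberTheory.EllipticCurves.GreenbergVatsal2000
  Literature.NumberTheory.EllipticCurves.FineSelmerCoefficientMap
  Literature.NumberTheory.GaloisRepresentations
  Summit.BirchSwinnertonDyer.Rank1Residual.X11b Summit.BirchSwinnertonDyer.Rank1Residual.X11b.AcSelmer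
  Summit.BirchSwinnertonDyer.Rank1Residual.X2.ResidualDevissage
  Summit.BirchSwinnertonDyer.Rank1Residual.X2.ResidualDevissageSelmer
  Summit.BirchSwinnertonDyer.Rank1Residual.X2.ResidualDevissageModules
  Summit.BirchSwinnertonDyer.BirchSwinnertonDyer.Theorems.UniversalToricDescentResidualSelmer
  Summit.BirchSwinnertonDyer.BirchSwinnertonDyer.Theorems.UniversalToricDescentResidualSelmerFinite

variable {K : Type u} [Field K] [NumberField K]

/-! ### §1 Backward transport of Castella's strict condition along `i_*` -/

section Generic

variable (H : Subgroup (absoluteGaloisGroup K)) [H.Normal]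
variable {Φ : Type u} [AddCommGroup Φ] [DistribMulAction (absoluteGaloisGroup K) Φ]
  [TopologicalSpace Φ] [DiscreteTopology Φ]
variable {M : Type u} [AddCommGroup M] [DistribMulAction (absoluteGaloisGroup K) M]
  [TopologicalSpace M] [DiscreteTopology M]
variable {Ψ : Type u} [AddCommGroup Ψ] [DistribMulAction (absoluteGaloisGroup K) Ψ]
  [TopologicalSpace Ψ] [DiscreteTopology Ψ]
variable {i : Φ →+ M} {hi : ∀ (g : absoluteGaloisGroup K) (x : Φ), i (g • x) = g • i x}
variable {q : M →+ Ψ}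

omit [H.Normal] [TopologicalSpace Ψ] [DiscreteTopology Ψ] in
/-- **Backward transport of the strict condition at `v` along `i_* : H¹(H, Φ) → H¹(H, M)`.** For a short
exact sequence `0 → Φ → M → Ψ → 0` of discrete `Γ_K`-modules with `Ψ^{H ⊓ D_v} ⊆ q(M^{H ⊓ D_v})` (e.g.
`Ψ^{H ⊓ D_v} = 0`: `H⁰(L_w, Ψ) = 0` at the place `w` of `L = K̄^H` singled out by the chosen embedding),
the map `H¹(H ⊓ D_v, Φ) → H¹(H ⊓ D_v, M)` is injective, hence: if `i_* c` satisfies Castella's STRICT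
condition at `v` (its restriction to `H ⊓ D_v` vanishes) then so does `c`. This is the local injectivity
«`r_v̄ : H¹(K_v̄, M_θ[p]) → H¹(K_v̄, M_θ)[p]` is injective since `H⁰(K_v̄, 𝔽_p(θ)) = 0`» of CGLS Lemma 13 /
the left column of the diagram of Prop. 17, in the `K_∞`-formulation.
[cite: CastellaGrossiLeeSkinner2022, §3 (arXiv:2008.02571 §1, Lemma 13 and Prop. 17)] -/
theorem mem_strictKer_strictDatum_of_subH1 (v : HeightOneSpectrum (𝓞 K))
    (hq : ∀ (g : absoluteGaloisGroup K) (m : M), q (g • m) = g • q m)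
    (hinj : Function.Injective i) (hexact : ∀ m, q m = 0 → m ∈ i.range) (hqi : ∀ x, q (i x) = 0)
    (hfix : ∀ y : Ψ, (∀ g : ↥(H ⊓ decomp v), g • y = y) →
      ∃ m : M, (∀ g : ↥(H ⊓ decomp v), g • m = m) ∧ q m = y)
    {c : subgroupH1 H Φ} (hc : subH1 H i hi c ∈ (AcSelmer.strictDatum M v).strictKer H) :
    c ∈ (AcSelmer.strictDatum Φ v).strictKer H := by
  rw [mem_strictKer_strictDatum_iff] at hc ⊢
  have e := congrArg (fun f : subgroupH1 H Φ →+ subgroupH1 (H ⊓ decomp v) M ↦ f c)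
    (resOfLe_comp_resH1Hom_id (inf_le_left : H ⊓ decomp v ≤ H) i (fun x m ↦ hi x m)
      (fun x m ↦ hi x m))
  simp only [AddMonoidHom.comp_apply] at e
  have hc' : resH1Hom (ContinuousMonoidHom.id (↥(H ⊓ decomp v))) i (fun x m ↦ hi x m)
      (resOfLe Φ (inf_le_left : H ⊓ decomp v ≤ H) c) = 0 := by
    rw [← e]; exact hc
  have hinjD : Function.Injective
      (resH1Hom (ContinuousMonoidHom.id (↥(H ⊓ decomp v))) i (fun x m ↦ hi x m)) :=
    pushH1_injective_of_surjOn_fixed (q := q) (fun x m ↦ hq (x : absoluteGaloisGroup K) m) hinj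
      hexact hqi hfix
  exact (injective_iff_map_eq_zero _).1 hinjD _ hc'

/-! ### §2 The kernel of `q_*` on `R_𝔭^Σ(L, M)` comes from `R_𝔭^Σ(L, Φ)` -/

/-- **Exactness of the residual devissage at `R_𝔭^Σ(L, M)`**: for `0 → Φ → M → Ψ → 0` exact (`M` with
continuous orbit maps, unramified outside `Σ ∪ {v ∣ p}`) and `Ψ^{H ⊓ D_𝔭} ⊆ q(M^{H ⊓ D_𝔭})`, a class
`c ∈ R_𝔭^Σ(L, M)` with `q_* c = 0` is `i_* a` for some `a ∈ R_𝔭^Σ(L, Φ)`: `a` exists in `H¹(H, Φ)` by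
exactness of `H¹(H, Φ) → H¹(H, M) → H¹(H, Ψ)`; it is unramified outside `Σ` because `M` is
(`mem_unramifiedOutside_of_subH1`) and strict at `𝔭` after every conjugation by §1 (`conj_σ i_* = i_* conj_σ`);
at the other places above `p` the datum is relaxed. (CGLS Prop. 17: the kernel of
`H¹_Gr^S(K, M_E[p]) → H¹_Gr^S(K, M_ψ[p])` is `H¹_Gr^S(K, M_φ[p])`.)
[cite: CastellaGrossiLeeSkinner2022, §3 (arXiv:2008.02571 §1, Prop. 17)] -/
theorem exists_mem_residualSelmer_subH1_eq (p : ℕ) (𝔭 : HeightOneSpectrum (𝓞 K))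
    (S₀ : Set (HeightOneSpectrum (𝓞 K)))
    (hq : ∀ (g : absoluteGaloisGroup K) (m : M), q (g • m) = g • q m)
    (hM : ∀ m : M, Continuous fun g : absoluteGaloisGroup K ↦ g • m)
    (hinj : Function.Injective i) (hqsurj : Function.Surjective q)
    (hexact : ∀ m, q m = 0 → m ∈ i.range) (hqi : ∀ x, q (i x) = 0)
    (hunr : ∀ v : HeightOneSpectrum (𝓞 K), v ∉ S₀ → ((p : ℕ) : 𝓞 K) ∉ v.asIdeal →
      ∀ x ∈ inertia v, ∀ m : M, x • m = m)
    (hfix : ∀ y : Ψ, (∀ g : ↥(H ⊓ decomp 𝔭), g • y = y) →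
      ∃ m : M, (∀ g : ↥(H ⊓ decomp 𝔭), g • m = m) ∧ q m = y)
    {c : subgroupH1 H M} (hc : c ∈ datumStrictSelmer H M p (AcSelmer.bdpData M p 𝔭) S₀)
    (hc0 : subH1 H q hq c = 0) :
    ∃ a ∈ datumStrictSelmer H Φ p (AcSelmer.bdpData Φ p 𝔭) S₀, subH1 H i hi a = c := by
  have hMH : ∀ m : M, Continuous fun h : H ↦ h • m := fun m ↦
    (hM m).comp continuous_subtype_val
  obtain ⟨a, rfl⟩ := mem_range_pushH1_of_pushH1_eq_zero (G := H) (i := i)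
    (hi := fun h x ↦ hi h x) hMH hinj hqsurj hexact hc0
  refine ⟨a, ?_, rfl⟩
  rw [mem_datumStrictSelmer_iff] at hc ⊢
  refine ⟨mem_unramifiedOutside_of_subH1 (hi := hi) p S₀ hq hinj hqsurj hexact hqi hunr hc.1,
    fun v hv σ ↦ ?_⟩
  by_cases hv𝔭 : v = 𝔭
  · subst hv𝔭
    have h := hc.2 v hv σ
    rw [AcSelmer.bdpData_self p v hv] at h ⊢
    rw [conjH1_subH1 (hi := hi)] at h
    exact mem_strictKer_strictDatum_of_subH1 H v (hi := hi) hq hinj hexact hqi hfix h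
  · rw [AcSelmer.bdpData_of_ne p 𝔭 hv hv𝔭, AcSelmer.strictKer_relaxedDatum_eq_top]
    exact AddSubgroup.mem_top _

/-! ### §3 Finiteness of `R_𝔭^Σ(L, M)` from `R_𝔭^Σ(L, Φ)` and `R_𝔭^Σ(L, Ψ)` -/

/-- **The residual devissage (CGLS Prop. 17, finiteness clause, `K_∞`-formulation).** For a short exact
sequence `0 → Φ →ⁱ M →^q Ψ → 0` of discrete `Γ_K`-modules (`M` with continuous orbit maps, unramified
outside `Σ ∪ {v ∣ p}`), a normal `H ≤ Γ_K`, a place `𝔭` with `Ψ^{H ⊓ D_𝔭} ⊆ q(M^{H ⊓ D_𝔭})`: if Castella's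
residual Selmer groups `R_𝔭^Σ(L, Φ)` and `R_𝔭^Σ(L, Ψ)` are finite, so is `R_𝔭^Σ(L, M)` — `q_*` maps
`R(M)` into `R(Ψ)` (tree `resH1Hom_id_mem_residualSelmer`) with kernel inside `i_*(R(Φ))` (§2), and an
additive map with finite kernel pulls finite sets back to finite sets.
[cite: CastellaGrossiLeeSkinner2022, §3 (arXiv:2008.02571 §1, Prop. 17: "In particular, H¹_{F_Gr}^S(K, M_E[p]) is finite")] -/
theorem finite_residualSelmer_of_subquotient (p : ℕ) (𝔭 : HeightOneSpectrum (𝓞 K))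
    (S₀ : Set (HeightOneSpectrum (𝓞 K)))
    (hi : ∀ (g : absoluteGaloisGroup K) (x : Φ), i (g • x) = g • i x)
    (hq : ∀ (g : absoluteGaloisGroup K) (m : M), q (g • m) = g • q m)
    (hM : ∀ m : M, Continuous fun g : absoluteGaloisGroup K ↦ g • m)
    (hinj : Function.Injective i) (hqsurj : Function.Surjective q)
    (hexact : ∀ m, q m = 0 → m ∈ i.range) (hqi : ∀ x, q (i x) = 0)
    (hunr : ∀ v : HeightOneSpectrum (𝓞 K), v ∉ S₀ → ((p : ℕ) : 𝓞 K) ∉ v.asIdeal →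
      ∀ x ∈ inertia v, ∀ m : M, x • m = m)
    (hfix : ∀ y : Ψ, (∀ g : ↥(H ⊓ decomp 𝔭), g • y = y) →
      ∃ m : M, (∀ g : ↥(H ⊓ decomp 𝔭), g • m = m) ∧ q m = y)
    (hΦ : (datumStrictSelmer H Φ p (AcSelmer.bdpData Φ p 𝔭) S₀ : Set (subgroupH1 H Φ)).Finite)
    (hΨ : (datumStrictSelmer H Ψ p (AcSelmer.bdpData Ψ p 𝔭) S₀ : Set (subgroupH1 H Ψ)).Finite) :
    (datumStrictSelmer H M p (AcSelmer.bdpData M p 𝔭) S₀ : Set (subgroupH1 H M)).Finite := by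
  set RM : AddSubgroup (subgroupH1 H M) := datumStrictSelmer H M p (AcSelmer.bdpData M p 𝔭) S₀
    with hRM
  let g : RM →+ subgroupH1 H Ψ := (subH1 H q hq).comp RM.subtype
  -- the kernel of `g` lies in the image of the finite set `R(Φ)`
  have hker : ((g.ker : AddSubgroup RM) : Set RM).Finite := by
    have hsub : ((g.ker : AddSubgroup RM) : Set RM) ⊆
        (fun r : RM ↦ (r : subgroupH1 H M)) ⁻¹'
          (subH1 H i hi '' (datumStrictSelmer H Φ p (AcSelmer.bdpData Φ p 𝔭) S₀ :
            Set (subgroupH1 H Φ))) := by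
      intro r hr
      obtain ⟨a, ha, har⟩ := exists_mem_residualSelmer_subH1_eq H p 𝔭 S₀ (hi := hi) hq hM hinj
        hqsurj hexact hqi hunr hfix r.2 ((AddMonoidHom.mem_ker).1 hr)
      exact ⟨a, ha, har⟩
    exact ((hΦ.image _).preimage Subtype.val_injective.injOn).subset hsub
  -- `g` maps everything into the finite set `R(Ψ)`
  have huniv : g ⁻¹' (datumStrictSelmer H Ψ p (AcSelmer.bdpData Ψ p 𝔭) S₀ : Set (subgroupH1 H Ψ)) =
      Set.univ := by
    ext r
    simp only [Set.mem_preimage, SetLike.mem_coe, Set.mem_univ, iff_true]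
    exact resH1Hom_id_mem_residualSelmer H p 𝔭 S₀ q hq (fun x m ↦ hq x m) r.2
  have hU : (Set.univ : Set RM).Finite := by
    rw [← huniv]
    exact AddMonoidHom.finite_preimage_of_finite_ker g hker hΨ
  have hcoe : (RM : Set (subgroupH1 H M)) = (fun r : RM ↦ (r : subgroupH1 H M)) '' Set.univ := by
    ext x
    simp only [SetLike.mem_coe, Set.image_univ, Set.mem_range, Subtype.exists, exists_prop,
      exists_eq_right]
  rw [hcoe]
  exact hU.image _

end Generic

/-! ### §4 Packaging by a `Γ_K`-stable subgroup `S ≤ M`: `Φ = S`, `Ψ = M ⧸ S` -/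

section Stable

variable (H : Subgroup (absoluteGaloisGroup K)) [H.Normal]
variable {M : Type u} [AddCommGroup M] [DistribMulAction (absoluteGaloisGroup K) M]
  [TopologicalSpace M] [DiscreteTopology M]

/-- **Residual devissage along a stable subgroup.** For a discrete `Γ_K`-module `M` with continuous
orbit maps, unramified outside `Σ ∪ {v ∣ p}`, and a `Γ_K`-stable subgroup `S ≤ M` such that the quotient
`M ⧸ S` has no non-zero element fixed by `H ⊓ D_𝔭` (the decomposition group of `L = K̄^H` at the chosen
place above `𝔭`): if `R_𝔭^Σ(L, S)` and `R_𝔭^Σ(L, M ⧸ S)` are finite then `R_𝔭^Σ(L, M)` is finite.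
(§3 for `i = S ↪ M`, `q = M ↠ M ⧸ S`.)
[cite: CastellaGrossiLeeSkinner2022, §3 (arXiv:2008.02571 §1, Prop. 17)] [cite: GreenbergVatsal2000, §2 p. 28 (display (16))] -/
theorem finite_residualSelmer_of_stableSubgroup (p : ℕ) (𝔭 : HeightOneSpectrum (𝓞 K))
    (S₀ : Set (HeightOneSpectrum (𝓞 K))) (S : StableSubgroup (absoluteGaloisGroup K) M)
    (hM : ∀ m : M, Continuous fun g : absoluteGaloisGroup K ↦ g • m)
    (hunr : ∀ v : HeightOneSpectrum (𝓞 K), v ∉ S₀ → ((p : ℕ) : 𝓞 K) ∉ v.asIdeal →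
      ∀ x ∈ inertia v, ∀ m : M, x • m = m)
    (hfix : ∀ y : S.Quot, (∀ g : ↥(H ⊓ decomp 𝔭), g • y = y) → y = 0)
    (hΦ : (datumStrictSelmer H S.Sub p (AcSelmer.bdpData S.Sub p 𝔭) S₀ :
      Set (subgroupH1 H S.Sub)).Finite)
    (hΨ : (datumStrictSelmer H S.Quot p (AcSelmer.bdpData S.Quot p 𝔭) S₀ :
      Set (subgroupH1 H S.Quot)).Finite) :
    (datumStrictSelmer H M p (AcSelmer.bdpData M p 𝔭) S₀ : Set (subgroupH1 H M)).Finite :=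
  finite_residualSelmer_of_subquotient H p 𝔭 S₀ (i := S.incl) (q := S.proj) S.incl_smul S.proj_smul hM
    S.incl_injective S.proj_surjective S.mem_range_incl_of_proj_eq_zero S.proj_incl hunr
    (surjOn_fixed_of_forall_fixed_eq_zero S.proj hfix) hΦ hΨ

end Stable

/-! ### §5 The elliptic-curve assembly: `Sel_𝔭^Σ(K_∞, E[p^∞])[p]` finite from the two residual pieces -/

section Curve

variable {K : Type} [Field K] [NumberField K] (W : WeierstrassCurve K) [W.IsElliptic] {p : ℕ}
  [Fact p.Prime] (κ : ZpExtension K p)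

omit [NumberField K] [W.IsElliptic] in
/-- The orbit maps of `E[p] = W.geomTorsion p` are continuous (`E(K̄)` is a discrete `Γ_K`-module,
tree `continuous_smul_geomPoints`). [cite: SerreGaloisCohomology1997, II.§1.1] -/
theorem continuous_smul_geomTorsion (n : ℤ) (P : W.geomTorsion n) :
    Continuous fun g : absoluteGaloisGroup K ↦ g • P :=
  continuous_of_injective_comp (ι := ((↑) : W.geomTorsion n → W.geomPoints)) Subtype.val_injective
    (W.continuous_smul_geomPoints (P : W.geomPoints))

omit [Fact p.Prime] in
/-- `E[p]` is unramified at every good place `v ∤ p`, in the form consumed by the devissage: the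
inertia group `I_v ≤ Γ_K` of the chosen prime above `v` (`GreenbergSelmer.inertia v`, the inertia group
of `𝔓₀ = adicCompletionPrime K v`) acts trivially on `W.geomTorsion p` (Néron–Ogg–Shafarevich, easy
direction). [cite: SilvermanAEC2009, Prop. VII.4.1(a)] -/
theorem smul_geomTorsion_eq_of_mem_inertia_chosen {v : HeightOneSpectrum (𝓞 K)}
    (hv : W.HasGoodReductionAt v) (hpv : ((p : ℕ) : 𝓞 K) ∉ v.asIdeal)
    {x : absoluteGaloisGroup K} (hx : x ∈ inertia v) (P : W.geomTorsion (p : ℤ)) : x • P = P := by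
  have hx' : x ∈ (adicCompletionPrime K v).inertia (absoluteGaloisGroup K) := by
    rw [inertia_adicCompletionPrime_eq_map_absInertia K v]
    exact hx
  exact W.smul_geomTorsion_eq_of_mem_inertia hv (n := (p : ℤ)) (by rw [Int.cast_natCast]; exact hpv)
    (adicCompletionPrime_mem_primesAbove K v) hx' P

/-- **`Sel_𝔭^Σ(K_∞, E[p^∞])[p]` is finite from the residual devissage along a stable line.** For an
elliptic curve `E = W/K` over a number field, ANY `ℤ_p`-extension `κ` (`K_∞ = K̄^{ker κ}`), a place `𝔭 ∋ p`
finitely decomposed in `K_∞` (`D_𝔭 ⊄ ker κ`), a set `Σ` containing every bad place prime to `p`, and a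
`Γ_K`-stable subgroup `Φ ≤ E[p]` whose quotient `E[p]/Φ` has no non-zero `G_{K_{∞,𝔭}}`-fixed element:
if Castella's residual Selmer groups `R_𝔭^Σ(K_∞, Φ)` and `R_𝔭^Σ(K_∞, E[p]/Φ)` are finite then
`{s ∈ Sel_𝔭^Σ(K_∞, E[p^∞]) | p s = 0}` is finite. Proof: §4 gives `R_𝔭^Σ(K_∞, E[p])` finite (`E[p]`
unramified outside `Σ ∪ {v ∣ p}` by Néron–Ogg–Shafarevich), then the tree's
`finite_selmerAc_pTorsion_of_finite_residualSelmer` (CGLS Prop. 18 / Lim–Sujatha). This is the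
reduction-type-free skeleton of CGLS §3 Prop. 3.2.1: its inputs are the two CHARACTER-level finiteness
statements (CGLS Prop. 14, Rubin + Hida). [cite: CastellaGrossiLeeSkinner2022, §3 (arXiv:2008.02571 §1, Props. 14, 17, 18)] -/
theorem finite_selmerAc_pTorsion_of_line_devissage
    {𝔭 : HeightOneSpectrum (𝓞 K)} (h𝔭 : ((p : ℕ) : 𝓞 K) ∈ 𝔭.asIdeal)
    (h𝔭dec : ¬ (decomp 𝔭 ≤ κ.kerSubgroup)) {S : Set (HeightOneSpectrum (𝓞 K))}
    (hS : ∀ v : HeightOneSpectrum (𝓞 K), v ∉ S → ((p : ℕ) : 𝓞 K) ∉ v.asIdeal → W.HasGoodReductionAt v)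
    (Φ : StableSubgroup (absoluteGaloisGroup K) (W.geomTorsion (p : ℤ)))
    (hfix : ∀ y : Φ.Quot, (∀ g : ↥(κ.kerSubgroup ⊓ decomp 𝔭), g • y = y) → y = 0)
    (hΦ : (datumStrictSelmer κ.kerSubgroup Φ.Sub p (AcSelmer.bdpData Φ.Sub p 𝔭) S :
      Set (subgroupH1 κ.kerSubgroup Φ.Sub)).Finite)
    (hΨ : (datumStrictSelmer κ.kerSubgroup Φ.Quot p (AcSelmer.bdpData Φ.Quot p 𝔭) S :
      Set (subgroupH1 κ.kerSubgroup Φ.Quot)).Finite) :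
    Set.Finite {s : selmerAc W p κ 𝔭 S | p • s = 0} := by
  have hunr' : ∀ v : HeightOneSpectrum (𝓞 K), v ∉ S → ((p : ℕ) : 𝓞 K) ∉ v.asIdeal →
      ∀ x ∈ inertia v, ∀ m : W.geomTorsion (p : ℤ), x • m = m :=
    fun v hvS hpv _ hx m ↦ smul_geomTorsion_eq_of_mem_inertia_chosen W (hS v hvS hpv) hpv hx m
  have hR : (datumStrictSelmer κ.kerSubgroup (W.geomTorsion (p : ℤ)) p
      (AcSelmer.bdpData _ p 𝔭) S :
      Set (Literature.NumberTheory.EllipticCurves.subgroupH1 κ.kerSubgroup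
        (W.geomTorsion (p : ℤ)))).Finite :=
    finite_residualSelmer_of_stableSubgroup κ.kerSubgroup p 𝔭 S Φ
      (continuous_smul_geomTorsion W (p : ℤ)) hunr' hfix hΦ hΨ
  exact finite_selmerAc_pTorsion_of_finite_residualSelmer W κ h𝔭 h𝔭dec hS hR

/-- **The `Σ = ∅` form (shape of stub B1 of line `birth`).** Under the hypotheses of
`finite_selmerAc_pTorsion_of_line_devissage` with `Σ` the set of bad places prime to `p` (or any set
containing them), Castella's `Σ`-PRIMITIVE Selmer group also has finite `p`-torsion:
`Sel_𝔭(K_∞, E[p^∞]) ≤ Sel_𝔭^Σ(K_∞, E[p^∞])` (`selmerAc_empty_le`). On the Leopoldt cell of crux K1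
(`K` Heegner, `κ` anticyclotomic, `p = 3`, `𝔭 = 𝔭′`, `Φ` the rational line) the remaining inputs are:
`D_{𝔭′} ⊄ ker κ` (tree `ZpExtension.decomp_not_le_kerSubgroup_above_of_isAnticyclotomic_holds`, Brink),
`(E[3]/Φ)^{G_{K_{∞,𝔭′}}} = 0` (the cell's non-anomalous clause up the pro-`3` tower), and the two residual
finiteness statements for the characters `φ|G_K`, `ψ|G_K` (CGLS Prop. 14 = Rubin + Hida `μ = 0`).
[cite: CastellaGrossiLeeSkinner2022, §3 (arXiv:2008.02571 §1, Prop. 18: "X_E is a quotient of X_E^S")] -/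
theorem finite_selmerAc_empty_pTorsion_of_line_devissage
    {𝔭 : HeightOneSpectrum (𝓞 K)} (h𝔭 : ((p : ℕ) : 𝓞 K) ∈ 𝔭.asIdeal)
    (h𝔭dec : ¬ (decomp 𝔭 ≤ κ.kerSubgroup)) {S : Set (HeightOneSpectrum (𝓞 K))}
    (hS : ∀ v : HeightOneSpectrum (𝓞 K), v ∉ S → ((p : ℕ) : 𝓞 K) ∉ v.asIdeal → W.HasGoodReductionAt v)
    (Φ : StableSubgroup (absoluteGaloisGroup K) (W.geomTorsion (p : ℤ)))
    (hfix : ∀ y : Φ.Quot, (∀ g : ↥(κ.kerSubgroup ⊓ decomp 𝔭), g • y = y) → y = 0)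
    (hΦ : (datumStrictSelmer κ.kerSubgroup Φ.Sub p (AcSelmer.bdpData Φ.Sub p 𝔭) S :
      Set (subgroupH1 κ.kerSubgroup Φ.Sub)).Finite)
    (hΨ : (datumStrictSelmer κ.kerSubgroup Φ.Quot p (AcSelmer.bdpData Φ.Quot p 𝔭) S :
      Set (subgroupH1 κ.kerSubgroup Φ.Quot)).Finite) :
    Set.Finite {s : selmerAc W p κ 𝔭 ∅ | p • s = 0} := by
  have hfin := finite_selmerAc_pTorsion_of_line_devissage W κ h𝔭 h𝔭dec hS Φ hfix hΦ hΨ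
  let g : ↥(selmerAc W p κ 𝔭 ∅) →+ ↥(selmerAc W p κ 𝔭 S) := AddSubgroup.inclusion selmerAc_empty_le
  have hg : Function.Injective g := AddSubgroup.inclusion_injective selmerAc_empty_le
  refine (hfin.preimage hg.injOn).subset fun s hs ↦ ?_
  show p • g s = 0
  rw [← map_nsmul, show p • s = 0 from hs, map_zero]

end Curve

end Summit.BirchSwinnertonDyer.BirchSwinnertonDyer.Theorems.CumulativeHeegnerInclusionAtThreeResidualDevissage

end
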